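import Summits.ValiantsHypothesis.ValiantsHypothesis.Theses.AnyonJets

/-!
# ValiantsHypothesis / AnyonJets — item `GrowthCToTarget` (stmt-ValiantsHypothesis-16746), closed

`JetCostGrowthC → JetExponentUnbounded`: if for some `a, n₀` every jet family `J_{n,k}` with
`1 ≤ k ≤ log₂ n`, `n ≥ n₀`, has `n^k ≤ L(J_{n,k})^a`, then for every `c` the family `k = c·a + 1`
beats `n^c` infinitely often: at any `n ≥ max n₀ 2^k` a bound `L ≤ n^c` would give
`n^{ca+1} ≤ L^a ≤ n^{ca}`, impossible for `n ≥ 2`. ℕ-arithmetic (the grounder's candidate proof on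
the item is not mounted here; this is an independent 20-line proof). HONEST FRAMING: bookkeeping;
`JetCostGrowthC` is an OPEN crux; nothing here is progress on `VP ≠ VNP`.
-/

-- layout Summits/ValiantsHypothesis/ValiantsHypothesis forces the duplicated namespace component
set_option linter.dupNamespace false

namespace Summit.ValiantsHypothesis.ValiantsHypothesis.Theorems.AnyonJets

/-- **Item `GrowthCToTarget` (stmt-ValiantsHypothesis-16746):** `JetCostGrowthC → JetExponentUnbounded`.
[folklore] -/
theorem growthCToTarget_proof : Theses.AnyonJets.GrowthCToTarget := by
  unfold Theses.AnyonJets.GrowthCToTarget Theses.AnyonJets.JetCostGrowthC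
    Theses.AnyonJets.JetExponentUnbounded
  intro hC
  dsimp only at hC ⊢
  obtain ⟨a, n₀, h⟩ := hC
  intro c
  refine ⟨c * a + 1, fun n₁ => ?_⟩
  set n := max (max n₀ n₁) (2 ^ (c * a + 1)) with hn
  have hn₀ : n₀ ≤ n := (le_max_left _ _).trans (le_max_left _ _)
  have hn₁ : n₁ ≤ n := (le_max_right _ _).trans (le_max_left _ _)
  have hpow : 2 ^ (c * a + 1) ≤ n := le_max_right _ _
  have hn2 : 2 ≤ n := le_trans (by calc 2 = 2 ^ 1 := by norm_num
    _ ≤ 2 ^ (c * a + 1) := Nat.pow_le_pow_right (by norm_num) (by omega)) hpow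
  have hk : c * a + 1 ≤ Nat.log 2 n := Nat.le_log_of_pow_le (by norm_num) hpow
  refine ⟨n, hn₁, ?_⟩
  have hL := h n hn₀ (c * a + 1) (by omega) hk
  by_contra hlt
  push Not at hlt
  -- `n^(ca+1) ≤ L^a ≤ (n^c)^a = n^(ca)`, contradiction with `n ≥ 2`
  have h1 : n ^ (c * a + 1) ≤ n ^ (c * a) :=
    hL.trans ((Nat.pow_le_pow_left hlt a).trans_eq (by rw [← pow_mul]))
  have h2 : n ^ (c * a) < n ^ (c * a + 1) := Nat.pow_lt_pow_right hn2 (by omega)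
  omega

end Summit.ValiantsHypothesis.ValiantsHypothesis.Theorems.AnyonJets
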